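import Summits.CriticalPhenomena.PercolationContinuityZ3.Theorems.PercNearOneGluingNoHeavyLowerTailCubicThreePointApexSplit
import Mathlib.Tactic.Ring
import Mathlib.Tactic.Linarith
import Mathlib.Tactic.Positivity
import HarnessLib

/-!
# `NoHeavyLowerTail` (stmt-CriticalPhenomena-4575) — block-stars are first-order local minimisers of `Ha` in the dense regime
# (the algebraic core: an AG-in-each-arm lemma)

Support file (prover prim-ineq-gen-2 gen 9, new-inequality factory; `--supports stmt-CriticalPhenomena-4575`).  Pure algebra over `ℝ`;
no measure theory, no named facts, no sorries.  Cell convention of `…CubicThreePointTerminalClosure` (`CubicThreePointTerminal.AG`):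
for an apex `s` and two further vertices `p, r` of a finite weighted graph, `(q,u₁,u₂,u₃,t) = (P(s|p|r), P(sp|r), P(sr|p), P(pr|s), P(spr))`,
so `P(s~p) = t+u₁`, `P(s~r) = t+u₂`, `P(s~p ∧ s~r) = t` and `Cov(1{s~p},1{s~r}) = t − (t+u₁)(t+u₂)`.

## What is recorded here (memo run/shared/lean/prim/prim-ineq-gen-2/REGIME-GEN9.md §4)
The dense half of the sharp cubic row SF3-Hmax, `t ≥ q ⇒ Ha = P(abc)² − P(ab)P(ac)P(bc) ≥ 0`, is an EQUALITY on every block-star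
(a cut vertex `s` separating `a, b, c` pairwise; arms `A ∋ a`, `B ∋ b`, `C ∋ c` arbitrary finite weighted graphs meeting only in `s`;
`x = P_A(a~s)`, `y = P_B(b~s)`, `z = P_C(c~s)`; `P(ab) = xy`, `P(abc) = xyz`, …).  PAPER STEP (exact, machine-checked on random
block-stars with blob arms, `lab/regime/localmin.py`, 0 mismatches): adding ONE new edge `e = {u,v}` of weight `ε` between the
arms `A ∋ u` and `B ∋ v` gives, to first order in `ε`,
    `Ha(G + εe) = ε · z²xy · [ A_pr·c_B + B_pr·c_A − A_pr·B_pr ] + O(ε²)`,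
where, for the arm triple `(s; a, u)` with cells `(q_A, a₁, a₂, a₃, t_A)`: `A_pr := a₃ = P_A(a~u, s apart)`, `c_A := t_A − (t_A+a₁)(t_A+a₂)
= Cov_A(1{a~s},1{u~s})`, `x = t_A + a₁`; likewise for `B` with `(s; b, v)`; and the same shape `x²yz·[B_pr·c_C + C_pr·c_B − B_pr·C_pr]`
for a chord between the two non-apex arms (chords inside one arm keep `Ha ≡ 0`).  THIS FILE proves the algebra that makes the bracket
nonnegative in the dense regime:
* `cov_sub_mul_eq` / `mul_le_cov_of_AG`: `c_A − x·A_pr = AG_A + a₂a₃`, hence `x·A_pr ≤ c_A` whenever `AG_A ≥ 0` (Gladkov) and `a₂, a₃ ≥ 0`;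
* `bracket_ge` / `starChord_bracket_nonneg`: therefore `A_pr·c_B + B_pr·c_A − A_pr·B_pr ≥ A_pr·B_pr·(x + y − 1) ≥ 0` as soon as `x + y ≥ 1`;
* `star_arm_sum_ge_one`: on a block-star the dense regime `t ≥ q` forces `x + y ≥ 1` for EVERY pair of arms
  (`xy ≥ xyz = t ≥ q ≥ (1−x)(1−y)`), via the identity `q − (1−x)(1−y) = x(1−y)(1−z) + y(1−x)(1−z)` (`star_q_sub`).
Consequently `d/dε Ha ≥ 0` at `ε = 0` for every single new edge at every block-star in the dense regime, with equality for the direct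
chord `a–b` exactly on the regime boundary `x + y = 1` (`bracket_terminal_chord`: the bracket is `(1−x)(1−y)(x+y−1)` there): block-stars
are first-order local minimisers of `Ha` on the realizable region — consistent with, and a structural explanation of, the tightness
pattern of the conjectured row (HMAX-GEN7.md I3 is the `u = a, v = b` case in closed form for all `ε`).  The sparse dual (fat triangles,
`Hb`, chords between different 2-terminal arms) is the appended section: `dHb/dε|₀ = (1−X)²(1−Y)(1−Z)[A_ub·d_AC + C_vc·d_AB] ≥ 0` for ALL
weights (`disc_cov_eq`, `dHb_fatTriangle_chord_nonneg`; paper step exact-checked by `lab/regime/fattri_formula.py`).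
[cite: Gladkov2024StrongFKG, Cor. 4.2 (the quadratic form AG ≥ 0 on every weighted graph)]
-/

namespace Summit.CriticalPhenomena.PercolationContinuityZ3.Theorems

namespace CubicThreePointApex

open CubicThreePointTerminal

/-! ### One arm: the covariance of the two connections to the cut vertex dominates `x · P(pr|s)` (AG) -/

/-- For an arm triple `(s; p, r)` on the simplex: `Cov(1{s~p},1{s~r}) − P(s~p)·P(pr|s) = AG + u₂u₃`, i.e.
`t − (t+u₁)(t+u₂) − (t+u₁)u₃ = AG + u₂u₃`. [folklore] -/
theorem cov_sub_mul_eq {q u₁ u₂ u₃ t : ℝ} (hσ : q + u₁ + u₂ + u₃ + t = 1) :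
    t - (t + u₁) * (t + u₂) - (t + u₁) * u₃ = AG q u₁ u₂ u₃ t + u₂ * u₃ := by
  have hq : q = 1 - u₁ - u₂ - u₃ - t := by linarith
  simp only [AG, hq]; ring

/-- Hence `P(s~p)·P(pr|s) ≤ Cov(1{s~p},1{s~r})` whenever `AG ≥ 0` (Gladkov) and `u₂, u₃ ≥ 0`. [folklore] -/
theorem mul_le_cov_of_AG {q u₁ u₂ u₃ t : ℝ} (hσ : q + u₁ + u₂ + u₃ + t = 1) (hu₂ : 0 ≤ u₂) (hu₃ : 0 ≤ u₃)
    (hag : 0 ≤ AG q u₁ u₂ u₃ t) :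
    (t + u₁) * u₃ ≤ t - (t + u₁) * (t + u₂) := by
  have e := cov_sub_mul_eq (q := q) (u₁ := u₁) (u₂ := u₂) (u₃ := u₃) (t := t) hσ
  nlinarith [mul_nonneg hu₂ hu₃]

/-! ### Two arms: the first-order bracket -/

/-- Abstract bracket lemma: if `x·A ≤ c_A`, `y·B ≤ c_B` and `A, B ≥ 0`, then `A·c_B + B·c_A − A·B ≥ A·B·(x + y − 1)`. [folklore] -/
theorem bracket_ge {A B cA cB x y : ℝ} (hA : 0 ≤ A) (hB : 0 ≤ B) (hcA : x * A ≤ cA) (hcB : y * B ≤ cB) :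
    A * B * (x + y - 1) ≤ A * cB + B * cA - A * B := by
  nlinarith [mul_le_mul_of_nonneg_left hcB hA, mul_le_mul_of_nonneg_left hcA hB]

/-- **The first-order bracket is nonnegative in the dense regime.**  Two arm triples `(s;a,u)` with cells `(qa,a₁,a₂,a₃,ta)` and `(s;b,v)`
with cells `(qb,b₁,b₂,b₃,tb)`, both on the simplex with nonnegative cells and `AG ≥ 0`; `x = ta + a₁ = P(a~s)`, `y = tb + b₁ = P(b~s)`.
If `x + y ≥ 1` then `a₃·c_B + b₃·c_A − a₃·b₃ ≥ 0` (`c_A = ta − (ta+a₁)(ta+a₂)`, `c_B` likewise) — the `ε`-coefficient of `Ha` at a block-star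
under the chord `u–v`, up to the factor `z²xy ≥ 0`. [folklore] -/
theorem starChord_bracket_nonneg {qa a₁ a₂ a₃ ta qb b₁ b₂ b₃ tb : ℝ}
    (hσa : qa + a₁ + a₂ + a₃ + ta = 1) (hσb : qb + b₁ + b₂ + b₃ + tb = 1)
    (ha₂ : 0 ≤ a₂) (ha₃ : 0 ≤ a₃) (hb₂ : 0 ≤ b₂) (hb₃ : 0 ≤ b₃)
    (hagA : 0 ≤ AG qa a₁ a₂ a₃ ta) (hagB : 0 ≤ AG qb b₁ b₂ b₃ tb)
    (hxy : 1 ≤ (ta + a₁) + (tb + b₁)) :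
    0 ≤ a₃ * (tb - (tb + b₁) * (tb + b₂)) + b₃ * (ta - (ta + a₁) * (ta + a₂)) - a₃ * b₃ := by
  have hcA := mul_le_cov_of_AG hσa ha₂ ha₃ hagA
  have hcB := mul_le_cov_of_AG hσb hb₂ hb₃ hagB
  have hbr := bracket_ge (x := ta + a₁) (y := tb + b₁) ha₃ hb₃ hcA hcB
  have h0 : 0 ≤ a₃ * b₃ * ((ta + a₁) + (tb + b₁) - 1) := mul_nonneg (mul_nonneg ha₃ hb₃) (by linarith)
  linarith

/-- The direct terminal chord `u = a`, `v = b` (arm `A` seen from `(s;a,a)`: `a₃ = P(a~a, s apart) = 1 − x`, `c_A = x(1−x)`): the bracket is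
`(1−x)(1−y)(x+y−1)` — it vanishes exactly on the regime boundary `x + y = 1` (cf. HMAX-GEN7 (I3)). [folklore] -/
theorem bracket_terminal_chord (x y : ℝ) :
    (1 - x) * (y * (1 - y)) + (1 - y) * (x * (1 - x)) - (1 - x) * (1 - y) = (1 - x) * (1 - y) * (x + y - 1) := by
  ring

/-! ### The dense regime forces `x + y ≥ 1` for every pair of arms of a block-star -/

/-- STAR law (arms `α, β, γ`): `q − (1−α)(1−β) = α(1−β)(1−γ) + β(1−α)(1−γ)` — `a|b|c` contains the event "neither `a` nor `b` reaches
the centre". [folklore] -/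
theorem star_q_sub (α β γ : ℝ) :
    (1 - (α * β + α * γ + β * γ) + 2 * (α * β * γ)) - (1 - α) * (1 - β)
      = α * (1 - β) * (1 - γ) + β * (1 - α) * (1 - γ) := by
  ring

/-- **Dense regime ⇒ pairwise arm sums ≥ 1.**  On a block-star with arm probabilities `α, β ∈ [0,1]`, `γ ≤ 1` (`t = αβγ`,
`q = 1 − (αβ+αγ+βγ) + 2αβγ`), `t ≥ q` implies `α + β ≥ 1` (and, by symmetry of the star cells, the same for every pair of arms):
`αβ ≥ αβγ = t ≥ q ≥ (1−α)(1−β)`. [folklore] -/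
theorem star_arm_sum_ge_one {α β γ : ℝ} (hα : 0 ≤ α) (hα1 : α ≤ 1) (hβ : 0 ≤ β) (hβ1 : β ≤ 1) (hγ1 : γ ≤ 1)
    (hreg : 1 - (α * β + α * γ + β * γ) + 2 * (α * β * γ) ≤ α * β * γ) :
    1 ≤ α + β := by
  have hq : (1 - α) * (1 - β) ≤ 1 - (α * β + α * γ + β * γ) + 2 * (α * β * γ) := by
    have e := star_q_sub α β γ
    nlinarith [mul_nonneg (mul_nonneg hα (sub_nonneg.mpr hβ1)) (sub_nonneg.mpr hγ1),
               mul_nonneg (mul_nonneg hβ (sub_nonneg.mpr hα1)) (sub_nonneg.mpr hγ1)]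
  have ht : α * β * γ ≤ α * β := by
    have : 0 ≤ α * β * (1 - γ) := mul_nonneg (mul_nonneg hα hβ) (sub_nonneg.mpr hγ1)
    linarith
  nlinarith

/-- **Block-stars are first-order local minimisers of `Ha` (algebraic core, packaged).**  For a block-star in the dense regime
(`t ≥ q` for its star cells `α = x, β = y, γ = z`) and any chord between the `a`-arm and the `b`-arm whose arm triples have nonnegative
cells, lie on the simplex and satisfy Gladkov's `AG ≥ 0`, the first-order coefficient `z²xy·[a₃c_B + b₃c_A − a₃b₃]` of `Ha` is `≥ 0`.
(The `b`–`c` chord is the same statement with `(y,z)` in place of `(x,y)` and the factor `x²yz`.) [folklore] -/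
theorem dHa_blockStar_chord_nonneg {qa a₁ a₂ a₃ ta qb b₁ b₂ b₃ tb z : ℝ}
    (hσa : qa + a₁ + a₂ + a₃ + ta = 1) (hσb : qb + b₁ + b₂ + b₃ + tb = 1)
    (hta : 0 ≤ ta) (ha₁ : 0 ≤ a₁) (ha₂ : 0 ≤ a₂) (ha₃ : 0 ≤ a₃) (hqa : 0 ≤ qa)
    (htb : 0 ≤ tb) (hb₁ : 0 ≤ b₁) (hb₂ : 0 ≤ b₂) (hb₃ : 0 ≤ b₃) (hqb : 0 ≤ qb)
    (hz : 0 ≤ z) (hz1 : z ≤ 1)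
    (hagA : 0 ≤ AG qa a₁ a₂ a₃ ta) (hagB : 0 ≤ AG qb b₁ b₂ b₃ tb)
    (hreg : 1 - ((ta + a₁) * (tb + b₁) + (ta + a₁) * z + (tb + b₁) * z) + 2 * ((ta + a₁) * (tb + b₁) * z)
              ≤ (ta + a₁) * (tb + b₁) * z) :
    0 ≤ z ^ 2 * (ta + a₁) * (tb + b₁)
          * (a₃ * (tb - (tb + b₁) * (tb + b₂)) + b₃ * (ta - (ta + a₁) * (ta + a₂)) - a₃ * b₃) := by
  have hx0 : 0 ≤ ta + a₁ := by linarith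
  have hx1 : ta + a₁ ≤ 1 := by linarith
  have hy0 : 0 ≤ tb + b₁ := by linarith
  have hy1 : tb + b₁ ≤ 1 := by linarith
  have hxy := star_arm_sum_ge_one hx0 hx1 hy0 hy1 hz1 hreg
  have hbr := starChord_bracket_nonneg hσa hσb ha₂ ha₃ hb₂ hb₃ hagA hagB hxy
  have : 0 ≤ z ^ 2 * (ta + a₁) * (tb + b₁) := mul_nonneg (mul_nonneg (pow_nonneg hz 2) hx0) hy0
  exact mul_nonneg this hbr

/-! ### Sparse dual (appended, gen 9): fat triangles are first-order local minimisers of `Hb` — regime-free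

PAPER STEP (exact, `lab/regime/fattri_formula.py`, 0 mismatches): a FAT TRIANGLE is three independent 2-terminal networks `AB ∋ a,b`, `AC ∋ a,c`,
`BC ∋ b,c` (disjoint interiors); with `Z = P_AB(a~b)`, `Y = P_AC(a~c)`, `X = P_BC(b~c)` its law is the triangle law and `Hb = q² − σ_aσ_bσ_c ≡ 0`.
Adding ONE edge `e = {u,v}` of weight `ε` between the interiors `u ∈ AB`, `v ∈ AC` gives
    `dHb/dε|₀ = (1−X)²(1−Y)(1−Z) · [ A_ub·d_AC + C_vc·d_AB ]`,
where for the arm triple `(u; a, b)` (apex `u`) with cells `(q′,u₁′,u₂′,u₃′,t′)`: `A_ub := u₂′ = P_AB(u~b, a apart)` and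
`d_AB := P(a≁b)·P(u~a ∨ u~b) − P(u~a ∨ u~b, a≁b) = (q′+u₁′+u₂′)(t′+u₁′+u₂′) − (u₁′+u₂′) = −Cov(1{a≁b}, 1{u~a∨b})` (likewise `C_vc`, `d_AC`);
the chord to the opposite terminal (`v = c`) is the case `C_vc = 1−Y`, `d_AC = 0`.  Since `Hb` is symmetric in `a,b,c` this covers every chord.
Below: `d_AB = AG′ + u₁′u₂′ ≥ 0` (`disc_cov_eq`; also plain Harris), so `dHb/dε|₀ ≥ 0` for ALL weights — no regime hypothesis is needed on
the sparse side (`dHb_fatTriangle_chord_nonneg`). -/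

/-- For an arm triple `(u; a, b)` on the simplex: `P(a≁b)·P(u~a∨u~b) − P(u~a∨u~b ∧ a≁b) = AG + u₁u₂`, i.e.
`(q+u₁+u₂)(t+u₁+u₂) − (u₁+u₂) = AG + u₁u₂`. [folklore] -/
theorem disc_cov_eq {q u₁ u₂ u₃ t : ℝ} (hσ : q + u₁ + u₂ + u₃ + t = 1) :
    (q + u₁ + u₂) * (t + u₁ + u₂) - (u₁ + u₂) = AG q u₁ u₂ u₃ t + u₁ * u₂ := by
  have hu₃ : u₃ = 1 - q - u₁ - u₂ - t := by linarith
  simp only [AG, hu₃]; ring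

/-- Hence `d = P(a≁b)·P(u~a∨b) − P(u~a∨b, a≁b) ≥ 0` whenever `AG ≥ 0` and `u₁, u₂ ≥ 0` (it is also a plain Harris covariance). [folklore] -/
theorem disc_cov_nonneg {q u₁ u₂ u₃ t : ℝ} (hσ : q + u₁ + u₂ + u₃ + t = 1) (hu₁ : 0 ≤ u₁) (hu₂ : 0 ≤ u₂)
    (hag : 0 ≤ AG q u₁ u₂ u₃ t) :
    0 ≤ (q + u₁ + u₂) * (t + u₁ + u₂) - (u₁ + u₂) := by
  rw [disc_cov_eq hσ]; nlinarith [mul_nonneg hu₁ hu₂]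

/-- **Fat triangles are first-order local minimisers of `Hb`, regime-free (algebraic core, packaged).**  Arm triples `(u;a,b)` with cells
`(qa,a₁,a₂,a₃,ta)` and `(v;a,c)` with cells `(qc,c₁,c₂,c₃,tc)` (apex = the chord endpoint; `a₂ = P(u~b, a apart)`, `c₂ = P(v~c, a apart)`),
nonnegative, on the simplex, with `AG ≥ 0`; `Y, Z ≤ 1` (and `X` arbitrary: it enters squared) the arm connection probabilities.  Then the `ε`-coefficient
`(1−X)²(1−Y)(1−Z)·[a₂·d_AC + c₂·d_AB]` of `Hb` is `≥ 0`. [folklore] -/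
theorem dHb_fatTriangle_chord_nonneg {qa a₁ a₂ a₃ ta qc c₁ c₂ c₃ tc X Y Z : ℝ}
    (hσa : qa + a₁ + a₂ + a₃ + ta = 1) (hσc : qc + c₁ + c₂ + c₃ + tc = 1)
    (ha₁ : 0 ≤ a₁) (ha₂ : 0 ≤ a₂) (hc₁ : 0 ≤ c₁) (hc₂ : 0 ≤ c₂)
    (hagA : 0 ≤ AG qa a₁ a₂ a₃ ta) (hagC : 0 ≤ AG qc c₁ c₂ c₃ tc)
    (hY : Y ≤ 1) (hZ : Z ≤ 1) :
    0 ≤ (1 - X) ^ 2 * (1 - Y) * (1 - Z)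
          * (a₂ * ((qc + c₁ + c₂) * (tc + c₁ + c₂) - (c₁ + c₂)) + c₂ * ((qa + a₁ + a₂) * (ta + a₁ + a₂) - (a₁ + a₂))) := by
  have hdA := disc_cov_nonneg hσa ha₁ ha₂ hagA
  have hdC := disc_cov_nonneg hσc hc₁ hc₂ hagC
  have hpre : 0 ≤ (1 - X) ^ 2 * (1 - Y) * (1 - Z) :=
    mul_nonneg (mul_nonneg (pow_two_nonneg _) (sub_nonneg.mpr hY)) (sub_nonneg.mpr hZ)
  exact mul_nonneg hpre (by nlinarith [mul_nonneg ha₂ hdC, mul_nonneg hc₂ hdA])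

end CubicThreePointApex

end Summit.CriticalPhenomena.PercolationContinuityZ3.Theorems
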